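import Literature.Probability.FitznerVanDerHofstad2017.BlockSummation

/-!
# [FvdH17] §6.2.1 (6.50): the right pieces `R^{(N)}` and the summation of Lemma 6.1 for general `M` — PROVED in abstract form

Source: R. Fitzner, R. van der Hofstad, *Mean-field behavior for nearest-neighbor percolation in `d > 10`*,
Electron. J. Probab. **22** (2017) no. 43 [FvdH17]; page and equation numbers are those of the extended version
arXiv:1506.07977v2 (92 pp.).  §6.2.1 (p. 65): "For `b = 0,1,2` and `x,y ∈ ℤ^d`, let
`P^{(0),b}(x,y) = P^{S,b}(x,y)`, `R^{(0),b}(x,y) = P^{E,b}(x,y)`, (6.48) and, for `N ≥ 1`, we recursively define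
… `R^{(N),a}(x,y) = Σ_{u,v∈ℤ^d} Σ_κ Σ_{b=0}^{2} B̄^{κ,a,b}(x,y,u,v) R^{(N−1),b}(u,v)`. (6.50)"
Lemma 6.1 (6.51) (p. 66): "For every `x ∈ ℤ^d`, `N ≥ 1` and `0 ≤ M ≤ N−1`,
`Ξ^{(N)}(x) ≤ Σ_{u_M,w_M,w_{M+1},z_{M+1}} Σ_{κ_M} Σ_{a,b} P^{(M),a}(u_M,w_M) Ā^{κ_M,a,b}(u_M,w_M,w_{M+1},z_{M+1})
R^{(N−M−1),b}(z_{M+1}−x, w_{M+1}−x)`"; p. 67: "Once the `x`-wise bounds of Lemma 6.1 are proven, we use a split as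
demonstrated in (6.5) to conclude the bounds stated in Propositions 5.5 and 5.6."  §5.1 Remark (p. 50): "we will
interpret starting vectors, such as `P⃗^S`, … as row vectors, while ending vectors such as `P⃗^E` and `h⃗^E` are
considered to be column vectors."

What this module proves — everything is kernel-checked; NOTHING here is a cited hypothesis.  `BlockSummation`
summed the `x`-wise bound at `M = N − 1` (`R^{(0)} = P^E`, no `B̄`); here the right half is added, in the same
abstract setting (sites any additive commutative group `G`, kernels in `[0, ∞]`, finite class type `ι`, finite
direction type `K`):
* `recR PE B̄` — the right pieces (6.48)/(6.50), typed verbatim (first pair of `B̄^{κ,a,b}` = the arguments of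
  `R^{(N),a}`, second pair = the pair shared with `R^{(N−1),b}`);
* `swapPairs M (u,v,x,y) := M(x,y,u,v)` and `matBR B̄ := matB (κ,a,b ↦ swapPairs B̄^{κ,a,b})`, entries
  `sup_v Σ_{κ,x,y} B̄^{κ,a,b}(x,y,0,v)` — the matrix of `B̄` read from its SECOND pair, which is the functional the
  Tonelli step for (6.50) consumes: `Σ_{x,y} Σ_{u,v} B̄(x,y,u,v) R(u,v) = Σ_{u,v} R(u,v) [Σ_{x,y} B̄(x,y,u,v)]
  ≤ [sup_{(u,v)} Σ_{x,y} B̄(x,y,u,v)] · Σ_{u,v} R(u,v)`;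
* `vecP_recR_succ_le`, `vecP_recR_le_pow_mulVec` — `(R⃗^{(N)})_a ≤ ((matBR B̄)^N R⃗^{(0)})_a` (column vector);
* `tsum_le_vecMul_pow_mul_pow_mulVec` — the `x`-wise bound of Lemma 6.1 for GENERAL `M` (left piece
  `P^{(M)} = recP PS B M`, right piece `R^{(m)} = recR PE B̄ m`, `M + m = N − 1`) sums to
  `Σ_x Ξ(x) ≤ P⃗S B^M Ā (matBR B̄)^m P⃗E`; at `m = 0` this is `BlockSummation.tsum_le_vecMul_pow_dotProduct`
  ((5.34)/(5.37)).

Reading note (recorded, not adjudicated; the package's DIVERGENCE.md D63 (d)): §5.1 "Elements of the bounds" (p. 49)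
prints `(B̄)_{a,b} = sup_v Σ_{ι,x,y} B̄^{ι,a,b}(0,v,x,y)`, the supremum being over the FIRST pair as for `(B)_{a,b}`;
the column bound proved here is stated with `matBR` (supremum over the second pair).  The two coincide whenever
`Σ_{x,y} B̄^{κ,a,b}(x,y,0,v)` and `Σ_{x,y} B̄^{κ,a,b}(0,v,x,y)` have the same supremum over `v` (e.g. under a
pair-exchange symmetry of the blocks); NO such identification is asserted in this module, which contains no
percolation block and produces no number.

NOT in this module: the blocks themselves, the proof of Lemma 6.1, the weighted bounds (5.35)–(5.36) and
(5.38)–(5.41) (which are where `B̄` enters the published numerical bounds), and any statement about dimensions.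
-/

noncomputable section

namespace Literature.Probability.FitznerVanDerHofstad2017.BlockSummation

open scoped ENNReal Matrix

section RightRecursion

variable {G ι K : Type*}

/-- A four-point block read from its second pair: `(swapPairs M)(u,v,x,y) = M(x,y,u,v)`. [folklore] -/
def swapPairs (M : G → G → G → G → ℝ≥0∞) : G → G → G → G → ℝ≥0∞ := fun u v x y => M x y u v

/-- `swapPairs` unfolds pointwise. [folklore] -/
@[simp] theorem swapPairs_apply (M : G → G → G → G → ℝ≥0∞) (u v x y : G) :
    swapPairs M u v x y = M x y u v := rfl

/-- Translation invariance is preserved by reading a block from its second pair. [folklore] -/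
theorem IsTransInv.swapPairs [AddCommGroup G] {M : G → G → G → G → ℝ≥0∞} (hM : IsTransInv M) :
    IsTransInv (swapPairs M) :=
  fun g u v x y => hM g x y u v

/-- The right pieces of the bounding diagrams, [FvdH17] (6.48)/(6.50): "`R^{(0),b}(x,y) = P^{E,b}(x,y)`" and, for
`N ≥ 1`, "`R^{(N),a}(x,y) = Σ_{u,v∈ℤ^d} Σ_κ Σ_{b=0}^{2} B̄^{κ,a,b}(x,y,u,v) R^{(N−1),b}(u,v)`" (length classes
`a, b ∈ ι`, directions `κ ∈ K`, final piece `PE`).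
[cite: FitznerVanDerHofstad2017, §6.2.1 (6.48) and (6.50) (arXiv:1506.07977v2 p. 65)] -/
def recR [Fintype ι] [Fintype K] (PE : ι → G → G → ℝ≥0∞) (Bb : K → ι → ι → G → G → G → G → ℝ≥0∞) :
    ℕ → ι → G → G → ℝ≥0∞
  | 0 => PE
  | N + 1 => fun a x y => ∑' u, ∑' v, ∑ κ, ∑ b, Bb κ a b x y u v * recR PE Bb N b u v

/-- `R^{(0),b} = P^{E,b}`. [cite: FitznerVanDerHofstad2017, (6.48) (arXiv:1506.07977v2 p. 65)] -/
@[simp] theorem recR_zero [Fintype ι] [Fintype K] (PE : ι → G → G → ℝ≥0∞)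
    (Bb : K → ι → ι → G → G → G → G → ℝ≥0∞) : recR PE Bb 0 = PE := rfl

/-- The recursion step (6.50), as an equation. [cite: FitznerVanDerHofstad2017, (6.50) (arXiv:1506.07977v2 p. 65)] -/
theorem recR_succ [Fintype ι] [Fintype K] (PE : ι → G → G → ℝ≥0∞)
    (Bb : K → ι → ι → G → G → G → G → ℝ≥0∞) (N : ℕ) (a : ι) (x y : G) :
    recR PE Bb (N + 1) a x y = ∑' u, ∑' v, ∑ κ, ∑ b, Bb κ a b x y u v * recR PE Bb N b u v := rfl

/-- The matrix of a block family READ FROM ITS SECOND PAIR: `(matBR B̄)_{a,b} = sup_v Σ_{κ,x,y} B̄^{κ,a,b}(x,y,0,v)`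
(`= matB` of the pair-exchanged family).  This is the functional consumed by the column step for (6.50); its
identification with the printed `(B̄)_{a,b} = sup_v Σ_{ι,x,y} B̄^{ι,a,b}(0,v,x,y)` of §5.1 is NOT asserted here
(see the module docstring).
[cite: FitznerVanDerHofstad2017, §6.2.1 (6.50) (arXiv:1506.07977v2 p. 65) and §5.1 "Elements of the bounds" (p. 49)] -/
def matBR [AddCommGroup G] [Fintype K] (Bb : K → ι → ι → G → G → G → G → ℝ≥0∞) : Matrix ι ι ℝ≥0∞ :=
  matB (fun κ a b => swapPairs (Bb κ a b))

/-- Entries of `matBR`. [folklore] -/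
theorem matBR_apply [AddCommGroup G] [Fintype K] (Bb : K → ι → ι → G → G → G → G → ℝ≥0∞) (a b : ι) :
    matBR Bb a b = ⨆ v, ∑' x, ∑' y, ∑ κ, Bb κ a b x y 0 v := rfl

/-- **One right-recursion step costs one matrix factor (column side):** if every `B̄^{κ,a,b}` is translation
invariant then `(R⃗^{(N+1)})_a ≤ Σ_b (matBR B̄)_{a,b} (R⃗^{(N)})_b`.
[cite: FitznerVanDerHofstad2017, §6.2.1 (6.50) with "we use a split as demonstrated in (6.5)" (arXiv:1506.07977v2 pp. 65, 67)] -/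
theorem vecP_recR_succ_le [AddCommGroup G] [Fintype ι] [Fintype K] {Bb : K → ι → ι → G → G → G → G → ℝ≥0∞}
    (hBb : ∀ κ a b, IsTransInv (Bb κ a b)) (PE : ι → G → G → ℝ≥0∞) (N : ℕ) (a : ι) :
    vecP (recR PE Bb (N + 1)) a ≤ ∑ b, matBR Bb a b * vecP (recR PE Bb N) b := by
  have hsum : ∀ x y, recR PE Bb (N + 1) a x y
      = ∑ b, ∑' u, ∑' v, recR PE Bb N b u v * ∑ κ, swapPairs (Bb κ a b) u v x y := by
    intro x y
    have inner : ∀ u v, (∑ κ, ∑ b, Bb κ a b x y u v * recR PE Bb N b u v)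
        = ∑ b, recR PE Bb N b u v * ∑ κ, swapPairs (Bb κ a b) u v x y := by
      intro u v
      rw [Finset.sum_comm]
      refine Finset.sum_congr rfl fun b _ => ?_
      rw [Finset.mul_sum]
      exact Finset.sum_congr rfl fun κ _ => mul_comm _ _
    simp only [recR_succ, inner, tsum_finsetSum]
  calc vecP (recR PE Bb (N + 1)) a
      = pairSum (fun x y => ∑ b, ∑' u, ∑' v, recR PE Bb N b u v * ∑ κ, swapPairs (Bb κ a b) u v x y) :=
        congrArg pairSum (funext fun x => funext fun y => hsum x y)
    _ = ∑ b, pairSum (fun x y => ∑' u, ∑' v, recR PE Bb N b u v * ∑ κ, swapPairs (Bb κ a b) u v x y) := by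
        simp only [pairSum, tsum_finsetSum]
    _ ≤ ∑ b, vecP (recR PE Bb N) b * matBR Bb a b :=
        Finset.sum_le_sum fun b _ =>
          pairSum_comp_le (recR PE Bb N b)
            (IsTransInv.finsetSum Finset.univ fun κ _ => (hBb κ a b).swapPairs)
    _ = ∑ b, matBR Bb a b * vecP (recR PE Bb N) b := Finset.sum_congr rfl fun b _ => mul_comm _ _

/-- **The column-vector bound:** `(R⃗^{(N)})_a ≤ ((matBR B̄)^N P⃗^E)_a` for every `N` (matrix power applied to the
column vector `P⃗^E`, [FvdH17] §5.1 Remark: "ending vectors such as `P⃗^E` and `h⃗^E` are considered to be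
column vectors").
[cite: FitznerVanDerHofstad2017, §6.2.1 (6.48), (6.50) and §5.1 Remark (arXiv:1506.07977v2 pp. 65, 50)] -/
theorem vecP_recR_le_pow_mulVec [AddCommGroup G] [Fintype ι] [DecidableEq ι] [Fintype K]
    {Bb : K → ι → ι → G → G → G → G → ℝ≥0∞} (hBb : ∀ κ a b, IsTransInv (Bb κ a b))
    (PE : ι → G → G → ℝ≥0∞) :
    ∀ (N : ℕ) (a : ι), vecP (recR PE Bb N) a ≤ (matBR Bb ^ N *ᵥ vecP PE) a
  | 0, a => by simp
  | N + 1, a => by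
      calc vecP (recR PE Bb (N + 1)) a
          ≤ ∑ b, matBR Bb a b * vecP (recR PE Bb N) b := vecP_recR_succ_le hBb PE N a
        _ ≤ ∑ b, matBR Bb a b * (matBR Bb ^ N *ᵥ vecP PE) b :=
            Finset.sum_le_sum fun b _ => mul_le_mul' le_rfl (vecP_recR_le_pow_mulVec hBb PE N b)
        _ = (matBR Bb ^ (N + 1) *ᵥ vecP PE) a := by
            rw [pow_succ', ← Matrix.mulVec_mulVec]
            rfl

/-- **Lemma 6.1 (6.51) for general `M`, summed over `x`** ([FvdH17] p. 67: "Once the `x`-wise bounds of Lemma 6.1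
are proven, we use a split as demonstrated in (6.5) …"): if `Ξ` obeys the (6.51)-shaped bound with left piece
`P^{(M)} = recP PS B M`, junction blocks `Ā^{κ,a,b}` and right piece `R^{(m)} = recR PE B̄ m` (all blocks translation
invariant), then `Σ_x Ξ(x) ≤ P⃗S B^M Ā (matBR B̄)^m P⃗E`.  For `m = 0` this is
`BlockSummation.tsum_le_vecMul_pow_dotProduct`, the first displays (5.34)/(5.37).
[cite: FitznerVanDerHofstad2017, Lemma 6.1 (6.51) and §6.2.1 (arXiv:1506.07977v2 pp. 65–67)] -/
theorem tsum_le_vecMul_pow_mul_pow_mulVec [AddCommGroup G] [Fintype ι] [DecidableEq ι] [Fintype K]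
    {B A Bb : K → ι → ι → G → G → G → G → ℝ≥0∞} (hB : ∀ κ a b, IsTransInv (B κ a b))
    (hA : ∀ κ a b, IsTransInv (A κ a b)) (hBb : ∀ κ a b, IsTransInv (Bb κ a b)) (Ξ : G → ℝ≥0∞)
    (PS PE : ι → G → G → ℝ≥0∞) (M m : ℕ)
    (hΞ : ∀ x, Ξ x ≤ ∑' u, ∑' w, ∑' t, ∑' z, ∑ κ, ∑ a, ∑ b,
      recP PS B M a u w * A κ a b u w t z * recR PE Bb m b (z - x) (t - x)) :
    ∑' x, Ξ x ≤ vecP PS ᵥ* matB B ^ M ᵥ* matAbar A ⬝ᵥ (matBR Bb ^ m *ᵥ vecP PE) := by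
  calc ∑' x, Ξ x
      ≤ ∑ a, ∑ b, vecP (recP PS B M) a * matAbar A a b * vecP (recR PE Bb m) b :=
        tsum_le_of_xSpaceBound hA Ξ _ _ hΞ
    _ ≤ ∑ a, ∑ b, (vecP PS ᵥ* matB B ^ M) a * matAbar A a b * (matBR Bb ^ m *ᵥ vecP PE) b :=
        Finset.sum_le_sum fun a _ => Finset.sum_le_sum fun b _ =>
          mul_le_mul' (mul_le_mul' (vecP_recP_le_vecMul_pow hB PS M a) le_rfl)
            (vecP_recR_le_pow_mulVec hBb PE m b)
    _ = vecP PS ᵥ* matB B ^ M ᵥ* matAbar A ⬝ᵥ (matBR Bb ^ m *ᵥ vecP PE) :=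
        sum_sum_mul_mul_eq_vecMul_dotProduct _ _ _

end RightRecursion

end Literature.Probability.FitznerVanDerHofstad2017.BlockSummation

end
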